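import Mathlib
import Summits.KontsevichZagierPeriods.KontsevichZagierPeriods.Theses.TorsionLogs
import Summits.KontsevichZagierPeriods.KontsevichZagierPeriods.Theorems.HyperbolicBlochOffTetraSectorKernelRungZeroLogRelations
import Summits.KontsevichZagierPeriods.KontsevichZagierPeriods.Theorems.TorsionLogsNeronTorsionSector
import Summits.KontsevichZagierPeriods.KontsevichZagierPeriods.Theorems.TorsionLogsNeronTorsionSectorStubParametersAlgebraic
import Literature.NumberTheory.Transcendental.KZKernelConjectureForms

/-!
# On-path lemma for the rung `NeronDuplicationChain` (F4) — conditional form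

`KontsevichZagierPeriods → NeronDuplicationChain` holds EXACTLY modulo the classical duplication
formula of the archimedean Néron function, read in the tree's integral-representation language
(`NeronDuplicationValueIdentity` below; Tate's normalisation `λ(2P) = 4λ(P) − log|2y| + ¼ log|Δ|`,
[SilvermanATAEC1994, Ch. VI, Thm 1.1 & Ex. 6.4(e)], [Lang1983, Ch. 13 §1], with
`I(P) = −log σ(u_P) + η₁^W u_P + c_E`, [WhittakerWatson1927, §§20.4–20.5]; the constants are
numerically certified to `1e-14` on five curves, `numerics/neron_dup.py`).  The identity is a
theorem of complex analysis absent from Mathlib/the tree, so it enters as a hypothesis (THE MODEL: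
a published result used as `(h : X)`); the unconditional `S → Rung` is therefore `pending-lander`.

Given the identity, the summit (in kernel form, `kzKernelConjecture_iff_isRational`) turns the
vanishing value of the explicit duplication element into a relation; the carrier `[1 < t < B, dt/t]`
exists because `g₂, g₃, e₁, x_P` are algebraic (`stub_parametersAlgebraic`, landed).
-/

namespace Summit.KontsevichZagierPeriods.KontsevichZagierPeriods.Cruxes.NeronTorsionFlex.NeronDuplication

open Literature.NumberTheory.Transcendental
open Summit.KontsevichZagierPeriods.HyperbolicBloch.OffTetraSectorKernel (exists_logRep)
open Summit.KontsevichZagierPeriods.KontsevichZagierPeriods.Cruxes.NeronTorsionSector.Translation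
  (logRep_value stub_parametersAlgebraic)

/-- The rung (verbatim copy of `Sketch.lean` / `Lines/NeronDuplication.lean`'s `stub_neronDuplicationChain`). -/
def NeronDuplicationChain : Prop :=
  ∀ (g₂ g₃ e₁ xP xR : ℝ) (f : ℝ → ℝ),
    (∀ x, f x = 4 * x ^ 3 - g₂ * x - g₃) → g₂ ^ 3 - 27 * g₃ ^ 2 ≠ 0 → f e₁ = 0 → 0 < e₁ →
    (∀ x, e₁ < x → 0 < f x) → e₁ < xP →
    xR = (12 * xP ^ 2 - g₂) ^ 2 / (16 * f xP) - 2 * xP → e₁ < xR →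
    ∀ (rI rJ rU rP : KZ.IntegralRep 2),
      rI.domain = {z | e₁ < z 1 ∧ z 1 < z 0 ∧ z 0 < xP} →
      Set.EqOn rI.integrand (fun z => z 1 / (Real.sqrt (f (z 1)) * Real.sqrt (f (z 0)))) rI.domain →
      rJ.domain = {z | e₁ < z 1 ∧ z 1 < z 0 ∧ z 0 < xR} →
      Set.EqOn rJ.integrand (fun z => z 1 / (Real.sqrt (f (z 1)) * Real.sqrt (f (z 0)))) rJ.domain →
      rU.domain = {z | xP < z 0 ∧ e₁ < z 1} →
      Set.EqOn rU.integrand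
        (fun z => (Real.sqrt (f (z 0)))⁻¹ * ((g₂ * z 1 + 2 * g₃) / (2 * (z 1) ^ 2 * Real.sqrt (f (z 1))))) rU.domain →
      rP.domain = {z | e₁ < z 0 ∧ e₁ < z 1} →
      Set.EqOn rP.integrand
        (fun z => (Real.sqrt (f (z 0)))⁻¹ * ((g₂ * z 1 + 2 * g₃) / (2 * (z 1) ^ 2 * Real.sqrt (f (z 1))))) rP.domain →
      ∃ (c : ℤ) (B : ℝ) (rB : KZ.IntegralRep 1), 1 < B ∧ IsAlgebraic ℚ B ∧
        B ^ c = (f xP) ^ 2 / (3 * e₁ ^ 2 - g₂ / 4) ^ 3 ∧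
        rB.domain = {t | 1 < t 0 ∧ t 0 < B} ∧ Set.EqOn rB.integrand (fun t => (t 0)⁻¹) rB.domain ∧
        (4 : ℤ) • KZ.of rJ - (16 : ℤ) • KZ.of rI + (4 : ℤ) • KZ.of rU - (3 : ℤ) • KZ.of rP + c • KZ.of rB
          ∈ KZ.relations

/-- NAMED CLASSICAL FACT (hypothesis, not a tree theorem): the duplication formula of the Néron
function on the real identity component, as a value identity between the four iterated/product
integrals: `4·I(2P) − 16·I(P) + 4·(u_P η₁) − 3·(ω₁η₁/2) + log (f(x_P)²/D³) = 0`, `D = 3e₁² − g₂/4`.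
[cite: SilvermanATAEC1994, VI Thm 1.1, Ex 6.4] [cite: Lang1983, Ch 13 §1] [cite: WhittakerWatson1927, §20.4] -/
def NeronDuplicationValueIdentity : Prop :=
  ∀ (g₂ g₃ e₁ xP xR : ℝ) (f : ℝ → ℝ),
    (∀ x, f x = 4 * x ^ 3 - g₂ * x - g₃) → g₂ ^ 3 - 27 * g₃ ^ 2 ≠ 0 → f e₁ = 0 → 0 < e₁ →
    (∀ x, e₁ < x → 0 < f x) → e₁ < xP →
    xR = (12 * xP ^ 2 - g₂) ^ 2 / (16 * f xP) - 2 * xP → e₁ < xR →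
    ∀ (rI rJ rU rP : KZ.IntegralRep 2),
      rI.domain = {z | e₁ < z 1 ∧ z 1 < z 0 ∧ z 0 < xP} →
      Set.EqOn rI.integrand (fun z => z 1 / (Real.sqrt (f (z 1)) * Real.sqrt (f (z 0)))) rI.domain →
      rJ.domain = {z | e₁ < z 1 ∧ z 1 < z 0 ∧ z 0 < xR} →
      Set.EqOn rJ.integrand (fun z => z 1 / (Real.sqrt (f (z 1)) * Real.sqrt (f (z 0)))) rJ.domain →
      rU.domain = {z | xP < z 0 ∧ e₁ < z 1} →
      Set.EqOn rU.integrand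
        (fun z => (Real.sqrt (f (z 0)))⁻¹ * ((g₂ * z 1 + 2 * g₃) / (2 * (z 1) ^ 2 * Real.sqrt (f (z 1))))) rU.domain →
      rP.domain = {z | e₁ < z 0 ∧ e₁ < z 1} →
      Set.EqOn rP.integrand
        (fun z => (Real.sqrt (f (z 0)))⁻¹ * ((g₂ * z 1 + 2 * g₃) / (2 * (z 1) ^ 2 * Real.sqrt (f (z 1))))) rP.domain →
      4 * rJ.value - 16 * rI.value + 4 * rU.value - 3 * rP.value
        + Real.log ((f xP) ^ 2 / (3 * e₁ ^ 2 - g₂ / 4) ^ 3) = 0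

/-- `D = 3e₁² − g₂/4 = f′(e₁)/4 > 0`: `e₁` is a simple root (Δ ≠ 0) right of which `f > 0`. -/
theorem disc_pos {g₂ g₃ e₁ : ℝ} {f : ℝ → ℝ} (hf : ∀ x, f x = 4 * x ^ 3 - g₂ * x - g₃)
    (hΔ : g₂ ^ 3 - 27 * g₃ ^ 2 ≠ 0) (hfe : f e₁ = 0) (he₁ : 0 < e₁)
    (hpos : ∀ x, e₁ < x → 0 < f x) : 0 < 3 * e₁ ^ 2 - g₂ / 4 := by
  have hg₃ : g₃ = 4 * e₁ ^ 3 - g₂ * e₁ := by have h := hf e₁; rw [hfe] at h; linarith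
  have hfac : ∀ x, f x = (x - e₁) * (4 * (x - e₁) ^ 2 + 12 * e₁ * (x - e₁) + 4 * (3 * e₁ ^ 2 - g₂ / 4)) := by
    intro x; rw [hf x, hg₃]; ring
  set D := 3 * e₁ ^ 2 - g₂ / 4 with hD
  -- `D ≠ 0`: otherwise `e₁` is a double root and `Δ = 0`
  have hD0 : D ≠ 0 := by
    intro h0
    apply hΔ
    have hg₂ : g₂ = 12 * e₁ ^ 2 := by linarith
    rw [hg₃, hg₂]; ring
  -- `D ≥ 0`: else `f < 0` just right of `e₁`
  rcases lt_or_gt_of_ne hD0 with hneg | hposD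
  · exfalso
    -- take `x = e₁ + t`, `t = min 1 (-D / (3 e₁ + 2))`
    set t := min 1 (-D / (3 * e₁ + 2)) with ht
    have h32 : 0 < 3 * e₁ + 2 := by linarith
    have ht0 : 0 < t := lt_min one_pos (div_pos (by linarith) h32)
    have ht1 : t ≤ 1 := min_le_left _ _
    have ht2 : t ≤ -D / (3 * e₁ + 2) := min_le_right _ _
    have ht3 : t * (3 * e₁ + 2) ≤ -D := (le_div_iff₀ h32).1 ht2
    have hx : e₁ < e₁ + t := by linarith
    have h := hpos (e₁ + t) hx
    rw [hfac] at h
    have hs : e₁ + t - e₁ = t := by ring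
    rw [hs] at h
    have hq : 4 * t ^ 2 + 12 * e₁ * t + 4 * D ≤ 0 := by nlinarith
    have : (e₁ + t - e₁) = t := by ring
    nlinarith
  · exact hposD

/-- **On-path lemma, conditional on the classical value identity.**
`NeronDuplicationValueIdentity → KontsevichZagierPeriods → NeronDuplicationChain`. -/
theorem NeronDuplicationChain_of_KontsevichZagierPeriods
    (hV : NeronDuplicationValueIdentity) (hS : KontsevichZagierPeriods) : NeronDuplicationChain := by
  intro g₂ g₃ e₁ xP xR f hf hΔ hfe he₁ hpos hxP hxR he₁R rI rJ rU rP hIdom hIint hJdom hJint hUdom hUint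
    hPdom hPint
  -- kernel form of the summit
  have hK : KZKernelConjecture := kzKernelConjecture_iff_isRational.mpr hS
  -- parameters are algebraic (read off the semialgebraic data of `rI`, `rP`)
  obtain ⟨hg₂, hg₃, he₁a, hxPa⟩ :=
    stub_parametersAlgebraic g₂ g₃ e₁ xP f hf hfe he₁ hpos hxP rI rP hIdom hIint hPdom hPint
  have hD : 0 < 3 * e₁ ^ 2 - g₂ / 4 := disc_pos hf hΔ hfe he₁ hpos
  set Q : ℝ := (f xP) ^ 2 / (3 * e₁ ^ 2 - g₂ / 4) ^ 3 with hQ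
  have hQpos : 0 < Q := div_pos (pow_pos (hpos xP hxP) 2) (pow_pos hD 3)
  have hQalg : IsAlgebraic ℚ Q := by
    have h4 : IsAlgebraic ℚ (4 : ℝ) := by simpa using isAlgebraic_algebraMap (R := ℚ) (A := ℝ) 4
    have h3 : IsAlgebraic ℚ (3 : ℝ) := by simpa using isAlgebraic_algebraMap (R := ℚ) (A := ℝ) 3
    have h14 : IsAlgebraic ℚ ((4 : ℝ)⁻¹) := h4.inv
    have hfx : IsAlgebraic ℚ (f xP) := by
      rw [hf]
      apply_rules [IsAlgebraic.sub, IsAlgebraic.mul, IsAlgebraic.pow]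
    have hDa : IsAlgebraic ℚ (3 * e₁ ^ 2 - g₂ / 4) := by
      rw [div_eq_mul_inv]
      apply_rules [IsAlgebraic.sub, IsAlgebraic.mul, IsAlgebraic.pow]
    rw [hQ, div_eq_mul_inv]
    exact (hfx.pow 2).mul (hDa.pow 3).inv
  -- choose the carrier `B > 1`, `c ∈ {1, 0, −1}` with `B ^ c = Q`
  obtain ⟨c, B, hB1, hBalg, hBc⟩ : ∃ (c : ℤ) (B : ℝ), 1 < B ∧ IsAlgebraic ℚ B ∧ B ^ c = Q := by
    rcases lt_trichotomy Q 1 with hlt | heq | hgt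
    · refine ⟨-1, Q⁻¹, (one_lt_inv₀ hQpos).2 hlt, hQalg.inv, by simp⟩
    · refine ⟨0, 2, by norm_num, by simpa using isAlgebraic_algebraMap (R := ℚ) (A := ℝ) 2, ?_⟩
      simp [heq]
    · exact ⟨1, Q, hgt, hQalg, by simp⟩
  obtain ⟨rB, hBdom, hBint⟩ := exists_logRep one_pos isAlgebraic_one hBalg
  have hBint' : Set.EqOn rB.integrand (fun t => (t 0)⁻¹) rB.domain := fun t _ => by
    rw [hBint]; simp
  refine ⟨c, B, rB, hB1, hBalg, hBc, hBdom, hBint', hK _ ?_⟩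
  -- the element evaluates to the classical identity
  have hval := hV g₂ g₃ e₁ xP xR f hf hΔ hfe he₁ hpos hxP hxR he₁R rI rJ rU rP hIdom hIint hJdom hJint
    hUdom hUint hPdom hPint
  have hBv : rB.value = Real.log B := logRep_value hB1.le rB hBdom hBint'
  have hlogQ : Real.log Q = (c : ℝ) * Real.log B := by rw [← hBc, Real.log_zpow]
  simp only [map_add, map_sub, map_zsmul, KZ.eval_of, zsmul_eq_mul, hBv, Int.cast_ofNat]
  rw [hQ] at hlogQ
  linarith [hval, hlogQ]

end Summit.KontsevichZagierPeriods.KontsevichZagierPeriods.Cruxes.NeronTorsionFlex.NeronDuplication
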